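import Summits.BirchSwinnertonDyer.BirchSwinnertonDyer.Theses.ThetaPartnerAtTwo
import Summits.BirchSwinnertonDyer.BirchSwinnertonDyer.Theorems.ThetaPartnerAtTwoSignedTransportAtTwoBridgeMazurTate
import Summits.BirchSwinnertonDyer.BirchSwinnertonDyer.Theorems.ThetaPartnerAtTwoSignedTransportAtTwoResidualFiniteness
import HarnessLib

/-!
# Crux `SignedTransportAtTwo` (stmt-BirchSwinnertonDyer-20333, route `ThetaPartnerAtTwo`): the algebraic `μ`/torsion
# binder AT THE RESIDUAL LEVEL — finiteness of the residual signed Selmer dual `X⁺/2X⁺` transfers from the CM partner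
# `A` to `W` along `W[2] ≅ A[2]` — implies Kμ2′ (torsion AND `μ = 0` of `X⁺(W)`), hence the crux BY NAME
# (lead prover bsd-wall-tp2-p1 g2; `--supports stmt-BirchSwinnertonDyer-20333`; closes nothing)

HONEST FRAMING. THEOREMS ONLY; every research input is an explicit hypothesis spelled inline; nothing about any curve is
asserted; BSD is not proved by any of this. Sixth composition of the line `bridge`.

WHY THIS SHAPE. Greenberg–Vatsal prove Thm. (1.4) ("`E₁[p] ≅ E₂[p]`, `Sel(E₁/ℚ_∞)_p` `Λ`-cotorsion with `μ = 0` ⇒ the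
same for `E₂`") on p. 3 in one line from the RESIDUAL statement: `μ = 0 ∧` cotorsion ⟺ `Sel(E/ℚ_∞)[p]` finite, and
`Sel(E/ℚ_∞)[p]` is "essentially determined by `E[p]`" (§2: the non-primitive residual Selmer groups coincide,
Prop. (2.8), and differ from the primitive ones by cofinitely generated local terms, Cor. (2.3)/Prop. (2.4)); B. D. Kim
(2009, Prop. 2.8–2.12, Cor. 2.13) runs the same argument for Kobayashi's `±` groups at odd supersingular `p`. The
binder `hfin2` (= registered stub `stub_fin2` of line `bridge` v6) is exactly that residual statement READ AT `2` on the
theta habitat, on the tree's objects: for signed dual data `D` (of `W`) and `D'` (of `A`) at the same `(κ, γ)`,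
`Finite (D'.X ⧸ 2·D'.X) → Finite (D.X ⧸ 2·D.X)` (Pontryagin-dually: `Sel⁺(A/ℚ_∞)[2]` finite ⇒ `Sel⁺(W/ℚ_∞)[2]`
finite). The `Λ`-algebra `X/pX` finite ⟺ (`X` torsion ∧ `μ(X) = 0`) for f.g. `X` is KERNEL-CHECKED
(`…ResidualFiniteness.lean`, any `p`), so Kμ2′ — including the TORSION of `X⁺(W)` at `2`, for which no separate
Kobayashi-Thm-1.2-at-2 input is needed — follows (`muTorsion2_of_fin2`), and with the landed compositions the crux BY
NAME (`signedTransportAtTwo_of_gvBinders_residual`: fin2 + Kλ2 + V2mt). `stub_fin2` is GV Prop. (2.8)/Kim Prop. 2.9–2.12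
READ AT `p = 2` for the `+` condition — unpublished at `2` (the `±` local condition at `2` and `E(ℚ_{∞,v})[2]` along the
tower enter); a research hypothesis here, not a fact. No sorry; standard axioms.

References: [GreenbergVatsal2000] p. 3, Thm. (1.4), Prop. (2.8), Cor. (2.3); [BDKim2009] Prop. 2.8–2.12, Cor. 2.13;
[Kobayashi2003] Thm. 1.2; [Washington1997] §13.2.
-/

set_option autoImplicit false
-- D-0017: single-problem summit, so `Summit.BirchSwinnertonDyer.BirchSwinnertonDyer.…` repeats a namespace BY DESIGN.
set_option linter.dupNamespace false

noncomputable section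

open scoped Classical MatrixGroups ModularForm BigOperators

open CongruenceSubgroup Polynomial WeierstrassCurve NumberField IsDedekindDomain Rat.HeightOneSpectrum
  Literature Literature.NumberTheory.EllipticCurves Literature.NumberTheory.EllipticCurves.IwasawaAlgebra
  Literature.NumberTheory.EllipticCurves.ModularForms
  Literature.NumberTheory.EllipticCurves.Rank1Residual
  Literature.NumberTheory.EllipticCurves.Kobayashi2003 ZpExtension
  Literature.NumberTheory.EllipticCurves.GreenbergVatsal2000
  Literature.NumberTheory.EllipticCurves.Sprung2017
  Summit.BirchSwinnertonDyer.Rank1Residual.X1.MuLambda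
  Summit.BirchSwinnertonDyer.Rank1Residual.Supersingular
  Summit.BirchSwinnertonDyer.Rank1Residual.X2.EulerFactorInvariants
  Summit.BirchSwinnertonDyer.BirchSwinnertonDyer.Theorems.TwoAdicTwistConverse

namespace Summit.BirchSwinnertonDyer.BirchSwinnertonDyer.Theorems.SignedTransportAtTwo

/-! ## §1. fin2 ⇒ Kμ2′ at `p = 2` -/

/-- **fin2 ⇒ Kμ2′.** If finiteness of the residual signed Selmer dual `X/2X` transfers from the partner's datum `D'` to
the curve's datum `D` (binder `hfin2`, GV Prop. (2.8) / Kim Prop. 2.9–2.12 shape READ AT `2`), then torsion AND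
`μ = 0` transfer: `D'.X` torsion with `μ = 0` ⇒ `D'.X/2` finite (`finite_quotient_of_muInvariant_eq_zero`) ⇒ `D.X/2`
finite (`hfin2`) ⇒ `D.X` torsion with `μ = 0` (`isTorsion_and_muInvariant_eq_zero_of_finite_quotient`) — the
registered stub `stub_muTorsion2` verbatim. [cite: GreenbergVatsal2000, p. 3 (proof of Thm. (1.4)) and Prop. (2.8)]
[cite: BDKim2009, Cor. 2.13] -/
theorem muTorsion2_of_fin2
    (hfin2 :
    ∀ (W : WeierstrassCurve ℚ) [W.IsElliptic] [W.IsGloballyMinimal] (A : WeierstrassCurve ℚ) [A.IsElliptic]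
      [A.IsGloballyMinimal], ¬ W.HasCM → W.analyticRank = 0 → GoodSS W 2 → W.frobeniusTrace 2 = 0 →
      A.HasCM → GoodSS A 2 → A.frobeniusTrace 2 = 0 →
    (∃ e : WeierstrassCurve.geomTorsion W (2 : ℤ) ≃+ WeierstrassCurve.geomTorsion A (2 : ℤ),
      ∀ (σ : Field.absoluteGaloisGroup ℚ) (P : WeierstrassCurve.geomTorsion W (2 : ℤ)), e (σ • P) = σ • e P) →
    ∀ (κ : ZpExtension ℚ 2) (γ : Field.absoluteGaloisGroup ℚ), κ.IsCyclotomic → κ.IsTopGenerator γ →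
    ∀ (D : SignedSelmerDualData W κ γ 1) (D' : SignedSelmerDualData A κ γ 1)
      [Module.Finite (IwasawaAlgebra 2) D.X] [Module.Finite (IwasawaAlgebra 2) D'.X],
      Finite (D'.X ⧸ (augIdealP 2 • ⊤ : Submodule (IwasawaAlgebra 2) D'.X)) →
      Finite (D.X ⧸ (augIdealP 2 • ⊤ : Submodule (IwasawaAlgebra 2) D.X))) :
    ∀ (W : WeierstrassCurve ℚ) [W.IsElliptic] [W.IsGloballyMinimal] (A : WeierstrassCurve ℚ) [A.IsElliptic]
      [A.IsGloballyMinimal], ¬ W.HasCM → W.analyticRank = 0 → GoodSS W 2 → W.frobeniusTrace 2 = 0 →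
      A.HasCM → GoodSS A 2 → A.frobeniusTrace 2 = 0 →
    (∃ e : WeierstrassCurve.geomTorsion W (2 : ℤ) ≃+ WeierstrassCurve.geomTorsion A (2 : ℤ),
      ∀ (σ : Field.absoluteGaloisGroup ℚ) (P : WeierstrassCurve.geomTorsion W (2 : ℤ)), e (σ • P) = σ • e P) →
    ∀ (κ : ZpExtension ℚ 2) (γ : Field.absoluteGaloisGroup ℚ), κ.IsCyclotomic → κ.IsTopGenerator γ →
    ∀ (D : SignedSelmerDualData W κ γ 1) (D' : SignedSelmerDualData A κ γ 1)
      [Module.Finite (IwasawaAlgebra 2) D.X] [Module.Finite (IwasawaAlgebra 2) D'.X],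
      Module.IsTorsion (IwasawaAlgebra 2) D'.X → D'.mu = 0 →
      Module.IsTorsion (IwasawaAlgebra 2) D.X ∧ D.mu = 0 := by
  intro W _ _ A _ _ hcm hr hss ha hAcm hAss hAa hiso κ γ hκ hγ D D' _ _ hXA hμA
  have hfinA : Finite (D'.X ⧸ (augIdealP 2 • ⊤ : Submodule (IwasawaAlgebra 2) D'.X)) :=
    finite_quotient_of_muInvariant_eq_zero hXA hμA
  have hfinW := hfin2 W A hcm hr hss ha hAcm hAss hAa hiso κ γ hκ hγ D D' hfinA
  exact isTorsion_and_muInvariant_eq_zero_of_finite_quotient hfinW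

/-! ## §2. The composition: fin2 + Kλ2 + V2mt ⇒ the crux BY NAME -/

/-- **The crux `SignedTransportAtTwo` BY NAME from the residual-finiteness transfer fin2 (`hfin2`), Kλ2 at `2` (`hlam2`)
and the Mazur–Tate-level analytic binder V2mt (`hV2mt`)** — `signedTransportAtTwo_of_gvBinders_mazurTate` (p527908)
fed with `muTorsion2_of_fin2 hfin2`. Nothing asserted beyond the binders.
[cite: GreenbergVatsal2000, Thm. (1.4), Prop. (2.8), Thm. (1.6)] [cite: BDKim2009, Cor. 2.13 (pp. 185–187)]
[cite: Vatsal1999, Thm. (1.10)] [cite: Kobayashi2003, Conjecture (p. 2)] -/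
theorem signedTransportAtTwo_of_gvBinders_residual
    (hfin2 :
    ∀ (W : WeierstrassCurve ℚ) [W.IsElliptic] [W.IsGloballyMinimal] (A : WeierstrassCurve ℚ) [A.IsElliptic]
      [A.IsGloballyMinimal], ¬ W.HasCM → W.analyticRank = 0 → GoodSS W 2 → W.frobeniusTrace 2 = 0 →
      A.HasCM → GoodSS A 2 → A.frobeniusTrace 2 = 0 →
    (∃ e : WeierstrassCurve.geomTorsion W (2 : ℤ) ≃+ WeierstrassCurve.geomTorsion A (2 : ℤ),
      ∀ (σ : Field.absoluteGaloisGroup ℚ) (P : WeierstrassCurve.geomTorsion W (2 : ℤ)), e (σ • P) = σ • e P) →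
    ∀ (κ : ZpExtension ℚ 2) (γ : Field.absoluteGaloisGroup ℚ), κ.IsCyclotomic → κ.IsTopGenerator γ →
    ∀ (D : SignedSelmerDualData W κ γ 1) (D' : SignedSelmerDualData A κ γ 1)
      [Module.Finite (IwasawaAlgebra 2) D.X] [Module.Finite (IwasawaAlgebra 2) D'.X],
      Finite (D'.X ⧸ (augIdealP 2 • ⊤ : Submodule (IwasawaAlgebra 2) D'.X)) →
      Finite (D.X ⧸ (augIdealP 2 • ⊤ : Submodule (IwasawaAlgebra 2) D.X)))
    (hlam2 :
    ∀ (W : WeierstrassCurve ℚ) [W.IsElliptic] [W.IsGloballyMinimal] (A : WeierstrassCurve ℚ) [A.IsElliptic]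
      [A.IsGloballyMinimal], ¬ W.HasCM → W.analyticRank = 0 → GoodSS W 2 → W.frobeniusTrace 2 = 0 →
      A.HasCM → GoodSS A 2 → A.frobeniusTrace 2 = 0 →
    (∃ e : WeierstrassCurve.geomTorsion W (2 : ℤ) ≃+ WeierstrassCurve.geomTorsion A (2 : ℤ),
      ∀ (σ : Field.absoluteGaloisGroup ℚ) (P : WeierstrassCurve.geomTorsion W (2 : ℤ)), e (σ • P) = σ • e P) →
    ∀ (κ : ZpExtension ℚ 2) (γ : Field.absoluteGaloisGroup ℚ), κ.IsCyclotomic → κ.IsTopGenerator γ →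
    ∀ (S₀ : Finset (HeightOneSpectrum (𝓞 ℚ))), (∀ v ∈ S₀, ((2 : ℕ) : 𝓞 ℚ) ∉ v.asIdeal) →
      (∀ v : HeightOneSpectrum (𝓞 ℚ), ¬ W.HasGoodReductionAt v → v ∈ S₀) →
      (∀ v : HeightOneSpectrum (𝓞 ℚ), ¬ A.HasGoodReductionAt v → v ∈ S₀) →
    ∀ (D : SignedSelmerDualData W κ γ 1) (D' : SignedSelmerDualData A κ γ 1)
      [Module.Finite (IwasawaAlgebra 2) D.X] [Module.Finite (IwasawaAlgebra 2) D'.X],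
      Module.IsTorsion (IwasawaAlgebra 2) D.X → Module.IsTorsion (IwasawaAlgebra 2) D'.X → D.mu = 0 → D'.mu = 0 →
      lambdaInvariant 2 D.X +
          ∑ v ∈ S₀, 2 ^ padicValNat 2 ((Rat.HeightOneSpectrum.natGenerator v ^ 2 - 1) / 8) * dMultiplicity W 2 v =
        lambdaInvariant 2 D'.X +
          ∑ v ∈ S₀, 2 ^ padicValNat 2 ((Rat.HeightOneSpectrum.natGenerator v ^ 2 - 1) / 8) * dMultiplicity A 2 v)
    (hV2mt :
    ∀ (W : WeierstrassCurve ℚ) [W.IsElliptic] [W.IsGloballyMinimal] (A : WeierstrassCurve ℚ) [A.IsElliptic]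
      [A.IsGloballyMinimal], ¬ W.HasCM → W.analyticRank = 0 → GoodSS W 2 → W.frobeniusTrace 2 = 0 →
      A.HasCM → GoodSS A 2 → A.frobeniusTrace 2 = 0 →
    (∃ e : WeierstrassCurve.geomTorsion W (2 : ℤ) ≃+ WeierstrassCurve.geomTorsion A (2 : ℤ),
      ∀ (σ : Field.absoluteGaloisGroup ℚ) (P : WeierstrassCurve.geomTorsion W (2 : ℤ)), e (σ • P) = σ • e P) →
    ∀ (γ : Field.absoluteGaloisGroup ℚ), IsCyclotomicVariable 2 γ →
    ∀ [NeZero (W.conductorNorm ℤ)] (f : CuspForm (Gamma0 (W.conductorNorm ℤ)) 2), IsNewformOf W f →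
    ∀ (ϖ : ℚ), (ϖ : ℝ) * W.realPeriodRat = plusPeriod f →
    ∀ (Lplus Lminus : IwasawaAlgebra 2), IsPollackPair f 2 Lplus Lminus →
    ∀ [NeZero (A.conductorNorm ℤ)] (fA : CuspForm (Gamma0 (A.conductorNorm ℤ)) 2), IsNewformOf A fA →
    ∀ (ϖA : ℚ), (ϖA : ℝ) * A.realPeriodRat = plusPeriod fA →
    ∀ (LplusA LminusA : IwasawaAlgebra 2), IsPollackPair fA 2 LplusA LminusA →
    ∀ (S₀ : Finset (HeightOneSpectrum (𝓞 ℚ))), (∀ v ∈ S₀, ((2 : ℕ) : 𝓞 ℚ) ∉ v.asIdeal) →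
      (∀ v : HeightOneSpectrum (𝓞 ℚ), ¬ W.HasGoodReductionAt v → v ∈ S₀) →
      (∀ v : HeightOneSpectrum (𝓞 ℚ), ¬ A.HasGoodReductionAt v → v ∈ S₀) →
    ∀ (G : IwasawaAlgebra 2) (m : ℕ), iwasawaToPowerSeries 2 G =
        PowerSeries.C ((2 : ℚ_[2]) ^ m * (ϖ : ℚ_[2])) * iwasawaToPowerSeries 2 (kobayashiL 1 Lplus Lminus) →
    ∀ (GA : IwasawaAlgebra 2) (m' : ℕ), iwasawaToPowerSeries 2 GA =
        PowerSeries.C ((2 : ℚ_[2]) ^ m' * (ϖA : ℚ_[2])) * iwasawaToPowerSeries 2 (kobayashiL 1 LplusA LminusA) →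
    ∃ u : ℤ_[2]ˣ, ∀ n : ℕ, Even n → ∃ q r : IwasawaAlgebra 2,
      PowerSeries.C (((2 : ℤ_[2]) ^ m' : ℤ_[2]) : ℚ_[2]) *
          (PowerSeries.C ((2 : ℚ_[2]) ^ m * (ϖ : ℚ_[2])) *
            ((mazurTateElement f 2 n).map (algebraMap ℚ ℚ_[2]) : PowerSeries ℚ_[2]) *
            iwasawaToPowerSeries 2 (eulerFactorProduct W 2 S₀)) -
        PowerSeries.C (((u : ℤ_[2]) * (2 : ℤ_[2]) ^ m : ℤ_[2]) : ℚ_[2]) *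
          (PowerSeries.C ((2 : ℚ_[2]) ^ m' * (ϖA : ℚ_[2])) *
            ((mazurTateElement fA 2 n).map (algebraMap ℚ ℚ_[2]) : PowerSeries ℚ_[2]) *
            iwasawaToPowerSeries 2 (eulerFactorProduct A 2 S₀)) =
      iwasawaToPowerSeries 2
        (PowerSeries.C ((2 : ℤ_[2]) ^ (m + m' + 1)) * q + toIwasawa 2 (cyclotomicOmega 2 n) * r)) :
    Summit.BirchSwinnertonDyer.BirchSwinnertonDyer.Theses.ThetaPartnerAtTwo.SignedTransportAtTwo :=
  signedTransportAtTwo_of_gvBinders_mazurTate (muTorsion2_of_fin2 hfin2) hlam2 hV2mt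

end Summit.BirchSwinnertonDyer.BirchSwinnertonDyer.Theorems.SignedTransportAtTwo

end
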